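import Summits.MatrixMultiplication.MatrixMultiplication.Theorems.GradedDesignFamily.Negative.SubfieldCellNineRowThreeFifteenCert
import Summits.MatrixMultiplication.MatrixMultiplication.Theorems.GradedDesignFamily.Negative.SubfieldCellNineRowThree

/-!
# Subfield cell `GL₂(𝔽₉) ⊃ SL₂(𝔽₃)` at level one — X-a: soundness of the β = 3 checker

**Honest framing.** VALUE = a kernel-checked soundness theorem for a finite certificate about ONE
finite cell of ONE skeleton line (`quadratic_extension_level_one_cell`, stub S3
`stub_subfieldCell`, crux `GradedDesignFamily`, route `LevelGradedCohnUmans`).  It is **not**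
progress on `Summit.MatrixMultiplication` and does **not** refute `stub_subfieldCell`.

## What is proved here

File IX (`SubfieldCellNineRowThreeFifteenCert`, parts IX-a … IX-e) evaluates, for every class
representative `a = y₂y₁⁻¹` and every `b = y₃y₁⁻¹`, the search-and-verify checker `checkRep15`.
This file proves the semantic content of its ingredients, in the standard model `(K, SL3, phiM)` of
files I–VIII and for a level-one separated pair `(Y, Z)` with `1 ∈ Z` and dual functionals
`E z₀` (`pairL (E z₀) (w z) = 4·[z = z₀]`):

* `σ_evS`, `ev_eq_zero_iff` — the `ℤ[√-3]`-valued sparse functionals `SFn` of file IX, evaluated on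
  the packed `λ`-code vector `cvT (mc g)`, compute (the conjugate-free image under `σ` of) the
  pairing `pairL (fnC F) (w g)` with the dual vector `w g` of file II; hence `killsL` / `killsD`
  are sound (`killsL_sound`, `killsD_sound`): a functional that "kills" a code list vanishes on the
  corresponding `w`-vectors, and one that kills a direction class vanishes on every matrix of that
  `kprop`-class (`pairL_eq_zero_of_kprop`, `kprop_dirRep`).
* `fam`, `fam_cons_indep`, `linIndep_diag` — linear independence bookkeeping for the garbage
  family `B` (vectors `w u`, `u` a product of quotients, all killed by every `E z₀`).
* `cap_fam`, `cap_fam_one` — the capacity inequality of file VIII-a in list form: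
  `|Z| + |B| + n ≤ 20` whenever `B` is an independent garbage family and `n` further functionals
  with a unit-diagonal witness pattern kill `B` and all `w z`, `z ∈ Z`.
* `nodeB_sound` — **soundness of the recursive certificate `nodeB`**: if `nodeB (Wc a b) fuel B`
  accepts, `B` is an independent garbage family of invertible codes, then `|Z| ≤ 15`.  At a leaf
  the capacity bound is used directly; at an inner node either some `z ∈ Z` escapes the pool
  (then a new independent garbage vector `w (q·z)` extends `B`, by `fam_cons_indep` with the
  escaping functional) or `Z` lies in the pool and the verified null-basis functionals `Ψ` with
  their diagonal witnesses give `|Z| + |B| + |Ψ| ≤ 20` (`cap_fam`), and the checker asserted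
  `|B| + |Ψ| ≥ 5`.

The root analysis (`checkCore15`: dead / four support-independent quotients / triangular triple /
two directions) and the final theorems are in file X-b (`SubfieldCellNineRowThreeFifteen`).
-/

set_option linter.dupNamespace false

namespace Summit.MatrixMultiplication.MatrixMultiplication.Theorems.GradedDesignFamily.Negative.SubfieldNine

open Matrix Module

/-! ### Sparse and dense evaluations as sums -/

/-- `evSp` as a sum over the support list. -/
theorem evSp_eq_sum (S : List ℕ) (F : Array ZW) (v : ℕ) :
    evSp S F v = (S.map fun p => ovalN (fld v p) * F.getD p 0).sum := by
  have h1 : evSp S F v = S.foldl (fun acc p => acc + ovalN (fld v p) * F.getD p 0) 0 := by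
    unfold evSp; congr 1; funext acc p; exact evStep_eq F v acc p
  rw [h1, foldl_add_eq, zero_add]

/-- `evS` as a sum over all positions. -/
theorem evS_eq_sum (F : Array ZW) (v : ℕ) :
    evS F v = ((List.range 20).map fun p => ovalN (fld v p) * F.getD p 0).sum := by
  have h1 : evS F v = (List.range 20).foldl (fun acc p => acc + ovalN (fld v p) * F.getD p 0) 0 := by
    unfold evS; congr 1; funext acc p; exact evStep_eq F v acc p
  rw [h1, foldl_add_eq, zero_add]

/-- For a well-formed sparse functional the sparse evaluation is the dense one. -/
theorem evSp_eq {S : List ℕ} {F : Array ZW} (h : sparseOK S F = true) (v : ℕ) :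
    evSp S F v = evS F v := by
  simp only [sparseOK, Bool.and_eq_true, decide_eq_true_eq, List.all_eq_true, List.mem_range,
    Bool.or_eq_true, beq_iff_eq, List.contains_iff_mem] at h
  obtain ⟨⟨hnd, hlt⟩, hz⟩ := h
  rw [evSp_eq_sum, evS_eq_sum, ← List.sum_toFinset _ hnd, ← List.sum_toFinset _ List.nodup_range]
  apply Finset.sum_subset
  · intro p hp
    rw [List.mem_toFinset] at hp ⊢
    exact List.mem_range.mpr (hlt p hp)
  · intro p hp hnp
    rw [List.mem_toFinset] at hp hnp
    rw [(hz p (List.mem_range.mp hp)).resolve_left hnp, mul_zero]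

/-! ### Evaluations are pairings with `w` -/

/-- the complex functional (indexed by coordinates) of an entry array -/
noncomputable def fnC (F : Array ZW) : Idx → ℂ := fun i => σ (F.getD (posI i) 0)

/-- `allIdx` has no duplicates. -/
theorem allIdx_nodup : allIdx.Nodup := by decide

/-- `allIdx` enumerates all coordinates. -/
theorem allIdx_toFinset : allIdx.toFinset = Finset.univ :=
  Finset.eq_univ_iff_forall.mpr fun i => List.mem_toFinset.mpr (mem_allIdx i)

/-- **Bridge:** `σ` of the dense evaluation on the packed vector of `g` is the pairing of the complex
functional with `w_g`. -/
theorem σ_evS (F : Array ZW) (g : Mat) : σ (evS F (cvT (mc g))) = pairL (fnC F) (w g) := by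
  rw [evS_eq, map_list_sum, List.map_map, pairL_apply, ← List.sum_toFinset _ allIdx_nodup,
    allIdx_toFinset]
  refine Finset.sum_congr rfl fun i _ => ?_
  simp only [Function.comp_apply, map_mul, fnC, w, vz, fact_vc g i, fact_cv, ovalN_ocode]

/-- A well-formed sparse functional vanishes on the packed vector of `g` iff its complex functional
pairs to zero with `w_g`. -/
theorem ev_eq_zero_iff (φ : SFn) (hφ : sparseOK φ.2.1 φ.2.2 = true) (g : Mat) :
    φ.ev (cvT (mc g)) = 0 ↔ pairL (fnC φ.2.2) (w g) = 0 := by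
  rw [SFn.ev, evSp_eq hφ, ← σ_evS, map_eq_zero_iff σ σ_injective]

/-- Unpacking `killsL`. -/
theorem killsL_sound {φ : SFn} {L : List MC} (h : killsL φ L = true) :
    sparseOK φ.2.1 φ.2.2 = true ∧ ∀ u ∈ L, pairL (fnC φ.2.2) (w (ofMC u)) = 0 := by
  simp only [killsL, Bool.and_eq_true, List.all_eq_true, beq_iff_eq] at h
  refine ⟨h.1, fun u hu => ?_⟩
  have := h.2 u hu
  rw [← mc_ofMC u] at this
  exact (ev_eq_zero_iff φ h.1 _).mp this

/-- Unpacking `killsD`. -/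
theorem killsD_sound {φ : SFn} (hφ : sparseOK φ.2.1 φ.2.2 = true) {ds : List ℕ}
    (h : killsD φ ds = true) : ∀ d ∈ ds, pairL (fnC φ.2.2) (w (ofMC (dirRep d))) = 0 := by
  simp only [killsD, List.all_eq_true, beq_iff_eq] at h
  intro d hd
  have := h d hd
  rw [← mc_ofMC (dirRep d)] at this
  exact (ev_eq_zero_iff φ hφ _).mp this

/-! ### Small algebraic facts -/

/-- Codes with non-zero code determinant are codes of invertible matrices. -/
theorem det2_ofMC {u : MC} (hu : detC u ≠ 0) : det2 (ofMC u) ≠ 0 :=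
  (fact_detC _).mpr (by rw [mc_ofMC]; exact fun h => hu (by rw [h]; decide))

/-- `w_g` lies in the hyperplane `Σ = 0` for invertible `g`. -/
theorem pairL_one_w' {g : Mat} (hg : det2 g ≠ 0) : pairL (fun _ => 1) (w g) = 0 := by
  rw [pairL_apply]
  simp only [mul_one, w, ← map_sum]
  rw [fact_hyper _ hg, map_zero]

/-- Pairing with a coordinate vector evaluates the functional. -/
theorem pairL_at_single (E : Idx → ℂ) (i : Idx) : pairL E (Pi.single i 1) = E i := by
  rw [pairL_apply]
  simp only [Pi.single_apply, ite_mul, one_mul, zero_mul, Finset.sum_ite_eq', Finset.mem_univ,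
    if_true]

/-- `posI` inverts `idxOfNat` below `20`. -/
theorem posI_idxOfNat {p : ℕ} (hp : p < 20) : posI (idxOfNat p) = p := by
  simp only [posI, idxOfNat]; omega

/-- Proportional λ-vectors pair to zero together. -/
theorem pairL_eq_zero_of_kprop {E : Idx → ℂ} {g₁ g₂ : Mat} (hk : kprop (vc g₁) (vc g₂))
    (h : pairL E (w g₁) = 0) : pairL E (w g₂) = 0 := by
  obtain ⟨c, hc0, hc⟩ := w_smul_of_kprop hk
  rw [hc, map_smul, smul_eq_mul] at h
  exact (mul_eq_zero.mp h).resolve_left hc0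

/-- A code and its direction representative have proportional λ-vectors. -/
theorem kprop_dirRep {c : MC} (hc : detC c ≠ 0) : kprop (vc (ofMC c)) (vc (ofMC (dirRep (dki c)))) := by
  rw [vc_eq, vc_eq, mc_ofMC, mc_ofMC]; exact (fact_dir c hc).2

/-- Rows of a matrix with non-zero diagonal and zero off-diagonal entries are independent. -/
theorem linIndep_diag {n : ℕ} (M : Fin n → Fin n → ℂ) (hd : ∀ l, M l l ≠ 0)
    (ho : ∀ l l', l ≠ l' → M l l' = 0) : LinearIndependent ℂ M := by
  rw [Fintype.linearIndependent_iff]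
  intro c hc l
  have h := congrFun hc l
  rw [Finset.sum_apply, Finset.sum_eq_single l (fun l' _ hl' => by
    rw [Pi.smul_apply, ho l' l hl', smul_zero]) (fun h => absurd (Finset.mem_univ l) h)] at h
  rw [Pi.smul_apply, smul_eq_mul, Pi.zero_apply] at h
  exact (mul_eq_zero.mp h).resolve_right (hd l)

/-! ### Garbage families -/

/-- the λ-vectors of a list of codes, as a family -/
noncomputable def fam (B : List MC) : Fin B.length → Idx → ℂ := fun j => w (ofMC (B.get j))

/-- `fam` of a cons. -/
theorem fam_cons (x : MC) (B : List MC) : fam (x :: B) = Fin.cons (w (ofMC x)) (fam B) := by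
  funext j; refine Fin.cases rfl (fun j => rfl) j

/-- **Extension:** a functional killing the family but not `w_x` keeps `x :: B` independent. -/
theorem fam_cons_indep {B : List MC} {x : MC} (hB : LinearIndependent ℂ (fam B)) (L : Idx → ℂ)
    (hL : ∀ u ∈ B, pairL L (w (ofMC u)) = 0) (hx : pairL L (w (ofMC x)) ≠ 0) :
    LinearIndependent ℂ (fam (x :: B)) := by
  rw [fam_cons, linearIndependent_finCons]
  refine ⟨hB, fun hmem => hx ?_⟩
  have hle : Submodule.span ℂ (Set.range (fam B)) ≤ LinearMap.ker (pairL L) := by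
    rw [Submodule.span_le]
    rintro _ ⟨j, rfl⟩
    rw [SetLike.mem_coe, LinearMap.mem_ker]
    exact hL _ (List.get_mem B j)
  exact LinearMap.mem_ker.mp (hle hmem)

/-- Labels of `nullBasis` are distinct. -/
theorem nullBasis_fst_nodup (rows : Array (Array ZW)) : ((nullBasis rows).map Prod.fst).Nodup := by
  unfold nullBasis
  generalize ffgj rows = t
  obtain ⟨A, pivs, D⟩ := t
  simp only [List.map_map, Function.comp_def, List.map_id']
  exact List.nodup_range.filter _

/-- the codes of the six quotients -/
def Wc (a b : GL (Fin 2) K) (k : ℕ) : MC := mc ((sixG a b k : GL (Fin 2) K) : Mat)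

/-- The six quotients, recovered from their codes. -/
theorem ofMC_Wc (a b : GL (Fin 2) K) (k : ℕ) : ofMC (Wc a b k) = ((sixG a b k : GL (Fin 2) K) : Mat) := by
  rw [Wc, ofMC_mc]

/-- Translates by the six quotients, on codes. -/
theorem mulT_Wc (a b : GL (Fin 2) K) (k : ℕ) (z : GL (Fin 2) K) :
    mulT (Wc a b k) (mc (z : Mat)) = mc ((sixG a b k * z : GL (Fin 2) K) : Mat) := by
  rw [Wc, mulT_eq, ← mc_mul2, mul2_eq, Units.val_mul]

/-- Membership in the pool: if all six translates of `z` have member directions, `mc z` is listed. -/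
theorem mem_poolL (a b : GL (Fin 2) K) {mem : ℕ → Bool} (z : GL (Fin 2) K)
    (hmem : ∀ k < 6, mem (dki (mc ((sixG a b k * z : GL (Fin 2) K) : Mat))) = true) :
    mc (z : Mat) ∈ poolL (Wc a b) mem := by
  simp only [poolL, List.mem_flatMap, List.mem_filter, List.mem_map, List.mem_range,
    List.all_eq_true]
  have hg : detC (mc ((sixG a b 0 * z : GL (Fin 2) K) : Mat)) ≠ 0 := detC_mc _ (det2_coe_ne_zero _)
  refine ⟨dki (mc ((sixG a b 0 * z : GL (Fin 2) K) : Mat)), ⟨(fact_dir _ hg).1, hmem 0 (by omega)⟩,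
    ⟨_, fact_dirCodes _ hg, ?_⟩, fun k hk => by rw [mulT_Wc]; exact hmem k hk⟩
  rw [Wc, invT_eq, ← mc_inv2 _ (det2_coe_ne_zero _), mulT_eq, ← mc_mul2, inv2_coe, mul2_eq,
    ← Units.val_mul, inv_mul_cancel_left]

section Sound

variable {Z : Finset (GL (Fin 2) K)} (E : {z // z ∈ Z} → Idx → ℂ)
  (hE : ∀ z₀ z : {z // z ∈ Z}, pairL (E z₀) (w ((z : GL (Fin 2) K) : Mat)) =
    if z = z₀ then 4 else 0)
include hE

/-- The capacity count for a garbage list `B` and `n` extra functionals. -/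
theorem cap_fam {B : List MC} (hind : LinearIndependent ℂ (fam B))
    (hgar : ∀ u ∈ B, ∀ z₀, pairL (E z₀) (w (ofMC u)) = 0) {n : ℕ} (F : Fin n → Idx → ℂ)
    (hFz : ∀ l (z : {z // z ∈ Z}), pairL (F l) (w ((z : GL (Fin 2) K) : Mat)) = 0)
    (hFg : ∀ l, ∀ u ∈ B, pairL (F l) (w (ofMC u)) = 0) (e : Fin n → Idx → ℂ)
    (he : LinearIndependent ℂ fun l => (fun l' => pairL (F l') (e l) : Fin n → ℂ)) :
    Z.card + B.length + n ≤ 20 :=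
  capacity E hE (fam B) hind (fun z₀ j => hgar _ (List.get_mem B j) z₀) F hFz
    (fun l j => hFg l _ (List.get_mem B j)) e he

/-- The capacity count for a garbage list with the single functional `𝟙`. -/
theorem cap_fam_one {B : List MC} (hdet : ∀ u ∈ B, detC u ≠ 0)
    (hind : LinearIndependent ℂ (fam B)) (hgar : ∀ u ∈ B, ∀ z₀, pairL (E z₀) (w (ofMC u)) = 0) :
    Z.card + B.length + 1 ≤ 20 := by
  refine cap_fam E hE hind hgar (![fun _ => (1 : ℂ)] : Fin 1 → Idx → ℂ) (fun l z => ?_)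
    (fun l u hu => ?_) (![Pi.single ((0 : Fin 10), (0 : Fin 2)) (1 : ℂ)] : Fin 1 → Idx → ℂ) ?_
  · fin_cases l; exact pairL_one_w _
  · fin_cases l; exact pairL_one_w' (det2_ofMC (hdet u hu))
  · rw [Fintype.linearIndependent_iff]
    intro c hc l
    fin_cases l
    have h0 := congrFun hc 0
    simp only [Fin.sum_univ_one, Pi.smul_apply, Pi.zero_apply, smul_eq_mul] at h0
    have e1 : pairL (![fun _ => (1 : ℂ)] 0) (![Pi.single ((0 : Fin 10), (0 : Fin 2)) (1 : ℂ)] 0)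
        = 1 := pairL_one_single _
    rw [e1, mul_one] at h0
    exact h0

/-- **Soundness of the recursive certificate.** -/
theorem nodeB_sound (a b : GL (Fin 2) K)
    (PW : ∀ k (z₀ : {z // z ∈ Z}), ∀ z ∈ Z,
      pairL (E z₀) (w ((sixG a b k * z : GL (Fin 2) K) : Mat)) = 0) :
    ∀ (fuel : ℕ) (B : List MC), nodeB (Wc a b) fuel B = true →
    (∀ u ∈ B, detC u ≠ 0) → LinearIndependent ℂ (fam B) →
    (∀ u ∈ B, ∀ z₀, pairL (E z₀) (w (ofMC u)) = 0) → Z.card ≤ 15 := by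
  intro fuel
  induction fuel with
  | zero => intro B h; simp [nodeB] at h
  | succ fuel ih =>
    intro B h hdet hind hgar
    rw [nodeB, Bool.or_eq_true, decide_eq_true_eq] at h
    rcases h with h4 | h
    · have := cap_fam_one E hE hdet hind hgar; omega
    simp only [Bool.and_eq_true, List.all_eq_true, decide_eq_true_eq, List.mem_range,
      Bool.or_eq_true] at h
    set rowsB := B.toArray.map fun u => rowOfV (cvT u)
    set Φ := nullBasis rowsB
    set wit := witA Φ
    obtain ⟨⟨⟨⟨hΦk, hΨlen⟩, hΨk⟩, hdiag⟩, hall⟩ := h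
    by_cases hA : ∃ z ∈ Z, ∃ k < 6,
        ¬ Φ.length ≤ wit.getD (dki (mc ((sixG a b k * z : GL (Fin 2) K) : Mat))) Φ.length
    · -- escape: a translate outside the span of the garbage, certified by a functional of `Φ`
      obtain ⟨z, hz, k, hk, hnm⟩ := hA
      set c := mc ((sixG a b k * z : GL (Fin 2) K) : Mat) with hc
      have hcdet : detC c ≠ 0 := detC_mc _ (det2_coe_ne_zero _)
      have hd := (fact_dir c hcdet).1
      rcases hall (dki c) hd with hm | hm
      · exact absurd hm hnm
      split at hm
      · rename_i φ hφ
        rw [Bool.and_eq_true, bne_iff_ne, ne_eq] at hm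
        obtain ⟨hev, hrec⟩ := hm
        have hφmem : φ ∈ Φ := List.mem_of_getElem? hφ
        obtain ⟨hφok, hφB⟩ := killsL_sound (hΦk φ hφmem)
        refine ih _ hrec (fun u hu => ?_) (fam_cons_indep hind (fnC φ.2.2) hφB fun h0 => hev ?_)
          (fun u hu z₀ => ?_)
        · rcases List.mem_cons.mp hu with hu | hu
          · rw [hu]; exact fact_dirRep _ hd
          · exact hdet u hu
        · rw [← mc_ofMC (dirRep (dki c))]; exact (ev_eq_zero_iff φ hφok _).mpr h0
        · rcases List.mem_cons.mp hu with hu | hu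
          · have e : ofMC c = ((sixG a b k * z : GL (Fin 2) K) : Mat) := by rw [hc, ofMC_mc]
            have hk' := kprop_dirRep hcdet
            rw [e] at hk'
            rw [hu]
            exact pairL_eq_zero_of_kprop hk' (PW k z₀ z hz)
          · exact hgar u hu z₀
      · exact absurd hm Bool.false_ne_true
    · -- all translates have member directions: every `z ∈ Z` is in the pool
      push Not at hA
      set mem : ℕ → Bool := fun d => decide (Φ.length ≤ wit.getD d Φ.length) with hmem
      have hpool : ∀ z ∈ Z, mc ((z : GL (Fin 2) K) : Mat) ∈ poolL (Wc a b) mem := fun z hz =>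
        mem_poolL a b z fun k hk => by rw [hmem]; exact decide_eq_true (hA z hz k hk)
      set pool := poolL (Wc a b) mem
      set pdirs := (pool.map dki).dedup
      set Ψ := (nullBasis (rowsB ++ (pdirs.map fun d => rowOfV (cvT (dirRep d))).toArray)).take
        (5 - B.length) with hΨ
      -- the functionals of Ψ kill `w_z`, `z ∈ Z`, and the garbage
      have hΨok : ∀ ψ ∈ Ψ, sparseOK ψ.2.1 ψ.2.2 = true := fun ψ hψ => (killsL_sound (hΨk ψ hψ).1).1
      have hΨz : ∀ ψ ∈ Ψ, ∀ z ∈ Z, pairL (fnC ψ.2.2) (w ((z : GL (Fin 2) K) : Mat)) = 0 := by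
        intro ψ hψ z hz
        have hzdet : detC (mc ((z : GL (Fin 2) K) : Mat)) ≠ 0 := detC_mc _ (det2_coe_ne_zero _)
        have hdz : dki (mc ((z : GL (Fin 2) K) : Mat)) ∈ pdirs :=
          List.mem_dedup.mpr (List.mem_map.mpr ⟨_, hpool z hz, rfl⟩)
        have h0 := killsD_sound (hΨok ψ hψ) (hΨk ψ hψ).2 _ hdz
        have hk' := kprop_symm (kprop_dirRep hzdet)
        rw [ofMC_mc] at hk'
        exact pairL_eq_zero_of_kprop hk' h0
      have hΨg : ∀ ψ ∈ Ψ, ∀ u ∈ B, pairL (fnC ψ.2.2) (w (ofMC u)) = 0 :=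
        fun ψ hψ => (killsL_sound (hΨk ψ hψ).1).2
      -- labels
      have hlab : (Ψ.map Prod.fst).Nodup := by
        rw [hΨ, List.map_take]
        exact (nullBasis_fst_nodup _).sublist (List.take_sublist _ _)
      have hlab' : ∀ l l' : Fin Ψ.length, l ≠ l' → (Ψ.get l).1 ≠ (Ψ.get l').1 := by
        have hpw : Ψ.Pairwise fun φ φ' => φ.1 ≠ φ'.1 := by
          have := hlab; rw [List.Nodup, List.pairwise_map] at this; exact this
        rw [List.pairwise_iff_get] at hpw
        intro l l' hne
        rcases lt_trichotomy l l' with h | h | h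
        · exact hpw l l' h
        · exact absurd h hne
        · exact (hpw l' l h).symm
      -- the diagonal pattern
      simp only [diagB, List.all_eq_true, Bool.and_eq_true, decide_eq_true_eq] at hdiag
      have hent : ∀ l l' : Fin Ψ.length, (Ψ.get l').2.2.getD (Ψ.get l).1 0 = 0 ↔
          (Ψ.get l).1 ≠ (Ψ.get l').1 := by
        intro l l'
        have := (hdiag _ (List.get_mem Ψ l)).2 _ (List.get_mem Ψ l')
        rw [beq_iff_eq, Bool.eq_iff_iff, beq_iff_eq, bne_iff_ne] at this
        exact this
      have hlt : ∀ l : Fin Ψ.length, (Ψ.get l).1 < 20 := fun l => (hdiag _ (List.get_mem Ψ l)).1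
      have := cap_fam E hE hind hgar (fun l : Fin Ψ.length => fnC (Ψ.get l).2.2)
        (fun l z => hΨz _ (List.get_mem Ψ l) z z.2) (fun l u hu => hΨg _ (List.get_mem Ψ l) u hu)
        (fun l => Pi.single (idxOfNat (Ψ.get l).1) 1) (by
          have key : (fun l l' : Fin Ψ.length => pairL (fnC (Ψ.get l').2.2)
              (Pi.single (idxOfNat (Ψ.get l).1) 1)) =
              fun l l' => σ ((Ψ.get l').2.2.getD (Ψ.get l).1 0) := by
            funext l l'; rw [pairL_at_single, fnC, posI_idxOfNat (hlt l)]
          rw [key]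
          refine linIndep_diag _ (fun l h0 => ?_) (fun l l' hne => ?_)
          · have := (hent l l).mp ((map_eq_zero_iff σ σ_injective).mp h0); exact this rfl
          · rw [(hent l l').mpr (hlab' l l' hne), map_zero])
      omega

end Sound

end Summit.MatrixMultiplication.MatrixMultiplication.Theorems.GradedDesignFamily.Negative.SubfieldNine
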